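import Summits.AtomisticToContinuum.FouriersLaw.Theorems.CageBudgetFeketeHeatVarianceCalculus
import HarnessLib

/-!
# Stub `stub_blockVariance` of line `dual-certificate`
(crux `CageBudgetFekete.HeatVarianceCeiling`, item stmt-AtomisticToContinuum-15770; `--supports` file, closes
nothing)

WHAT. The registered stub S1 of the crux's skeleton
(`Cruxes/HeatVarianceCeiling/Lines/dual_certificate.lean`): the Einstein–Helfand / Følner representation of the
equilibrium heat variance of the pinned anharmonic chain `P = pinnedChain ω₂ lam β γ` (`ω₂, lam, β > 0`) in a
shift-invariant DLR state `μ` at `T > 0` preserved by a dynamics `D` with absolutely convergent summed current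
correlations: for every `τ ≥ 0`,
`n⁻¹ ∫ (∫_{(0,τ]} J_n(φ_s σ) ds)² dμ(σ) → V(τ) = 2∫_{(0,τ]}(τ−s)C(s)ds` as `n → ∞`,
`J_n = Σ_{i<n} j_i` the block current, `C = D.currentCorrelation μ`.

HOW. (i) The Fubini identity `∫ (∫_{(0,τ]} g(φ_u σ) du)² dμ(σ) = 2∫_{(0,τ]}(τ−u)F_g(u)du`,
`F_g(u) = ∫ g·(g∘φ_u) dμ`, for `g ∈ L²(μ)` measurable, continuous along the orbits of the carrier, with
continuous `F_g` (`bv_integral_sq_integral_Ioc_comp_flow`; the computation inside the tree's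
`InfiniteChainDynamics.integral_Ioc_sub_mul_nonneg`, returned as an identity), applied to `g = J_n`
(`F_{J_n} = Φ_n` continuous by `continuous_integral_block_mul_block_flow` under the superstability estimate of
the shift-invariant state). (ii) `n⁻¹Φ_n(u) → C(u)` pointwise (`tendsto_inv_mul_integral_block_mul_block_flow`),
where the a.e. commutation of `D.flow t` with every lattice translation comes from dynamics rigidity
(`flow_ae_eq_canonical`: `D` is a.e. the canonical Buttà–Marchioro dynamics, which commutes with the
translations everywhere). (iii) Dominated convergence on `(0,τ]` with `|n⁻¹Φ_n(u)| ≤ n⁻¹Φ_n(0) ≤ B`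
(`abs_integral_block_mul_block_flow_le`), exactly as in the tree's `currentCorrelation_positiveType`.
The momentum-reversal invariance, the a.e. `shift`-covariance and the continuity of `C` in the signature are
not used. [cite: Helfand1960] [cite: Doyon2022, Lemma 4.5]
-/

noncomputable section

namespace Summit.AtomisticToContinuum.FouriersLaw.Theorems.HeatVarianceCeiling.DualCertificate

open MeasureTheory Filter Set Function Topology
open scoped BigOperators ENNReal
open Literature.MathematicalPhysics.KineticTheory.HeatConduction

/-- **Fubini identity for the doubly integrated autocorrelation.** For a `μ`-preserving dynamics `D`
(`μ` finite), `g ∈ L²(μ)` measurable and continuous along the orbits of the carrier, with continuous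
autocorrelation `F(t) = ∫ g · (g ∘ φ_t) dμ`, and `t ≥ 0`:
`∫ (∫_{(0,t]} g(φ_u σ) du)² dμ(σ) = 2 ∫_{(0,t]} (t - u) F(u) du`
(Fubini for the jointly measurable modification `(u, σ) ↦ 1_S(σ) g(φ_u σ)` on a measurable full-measure
part `S` of the carrier, stationarity `∫ g(φ_s σ) g(φ_u σ) dμ = F(u - s)`, and
`integral_Ioc_integral_Ioc_sub_eq`). The computation of the tree's
`InfiniteChainDynamics.integral_Ioc_sub_mul_nonneg`, stated as an identity. [folklore] -/
theorem bv_integral_sq_integral_Ioc_comp_flow {P : OscillatorChain} (D : InfiniteChainDynamics P)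
    {μ : Measure ChainConfig} [IsFiniteMeasure μ] (hD : D.PreservesMeasure μ)
    {g : ChainConfig → ℝ} (hg : Measurable g) (hg2 : MemLp g 2 μ)
    (hcont : ∀ σ ∈ D.carrier, Continuous fun t => g (D.flow t σ))
    (hF : Continuous fun t => ∫ σ, g σ * g (D.flow t σ) ∂μ) {t : ℝ} (ht : 0 ≤ t) :
    ∫ σ, (∫ u in Ioc 0 t, g (D.flow u σ)) ^ 2 ∂μ =
      2 * ∫ u in Ioc 0 t, (t - u) * ∫ σ, g σ * g (D.flow u σ) ∂μ := by
  -- a measurable full-measure subset of the carrier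
  obtain ⟨Z, hZsub, hZm, hZ0⟩ := exists_measurable_superset_of_null (ae_iff.1 hD.1)
  set S : Set ChainConfig := Zᶜ with hSdef
  have hSm : MeasurableSet S := hZm.compl
  have hSsub : S ⊆ D.carrier := fun σ hσ => by_contra fun h => hσ (hZsub h)
  have hSae : ∀ᵐ σ ∂μ, σ ∈ S := by
    rw [ae_iff]
    have : {a | ¬a ∈ S} = Z := by ext a; simp [hSdef]
    rw [this]
    exact hZ0
  -- the jointly measurable modification of `(u, σ) ↦ g (φ_u σ)`
  set K : ℝ → ChainConfig → ℝ := fun u σ => S.indicator (fun σ => g (D.flow u σ)) σ with hKdef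
  have hKm : ∀ u, Measurable (K u) := fun u => (hg.comp (hD.2 u).measurable).indicator hSm
  have hKc : ∀ σ, Continuous fun u => K u σ := by
    intro σ
    by_cases hσ : σ ∈ S
    · simp only [hKdef, indicator_of_mem hσ]
      exact hcont σ (hSsub hσ)
    · simp only [hKdef, indicator_of_notMem hσ]
      exact continuous_const
  have hKjm : Measurable (Function.uncurry K) :=
    measurable_uncurry_of_continuous_of_measurable hKc hKm
  have hKae : ∀ u, K u =ᵐ[μ] fun σ => g (D.flow u σ) := fun u => by
    filter_upwards [hSae] with σ hσ
    simp only [hKdef, indicator_of_mem hσ]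
  have hK2 : ∀ u, MemLp (K u) 2 μ := fun u =>
    (hg2.comp_measurePreserving (hD.2 u)).ae_eq (hKae u).symm
  set F : ℝ → ℝ := fun t => ∫ σ, g σ * g (D.flow t σ) ∂μ with hFdef
  set A : ℝ := ∫ σ, g σ ^ 2 ∂μ with hAdef
  have hKK : ∀ s u, ∫ σ, K s σ * K u σ ∂μ = F (u - s) := by
    intro s u
    show ∫ σ, K s σ * K u σ ∂μ = ∫ σ, g σ * g (D.flow (u - s) σ) ∂μ
    rw [← D.integral_comp_flow_mul_comp_flow_eq hD hg s u]
    refine integral_congr_ae ?_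
    filter_upwards [hSae] with σ hσ
    simp only [hKdef, indicator_of_mem hσ]
  have hKKabs : ∀ s u, ∫ σ, |K s σ * K u σ| ∂μ ≤ A := by
    intro s u
    have hae : (fun σ => |K s σ * K u σ|) =ᵐ[μ] fun σ => |g (D.flow s σ) * g (D.flow u σ)| := by
      filter_upwards [hSae] with σ hσ
      simp only [hKdef, indicator_of_mem hσ]
    rw [integral_congr_ae hae]
    exact D.integral_abs_comp_flow_mul_comp_flow_le hD hg hg2 s u
  have hFabs : ∀ r, |F r| ≤ A := fun r => D.abs_integral_mul_comp_flow_le hD hg hg2 r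
  -- the product measure on the time square
  set ρ : Measure ℝ := volume.restrict (Ioc (0:ℝ) t) with hρdef
  set π : Measure (ℝ × ℝ) := ρ.prod ρ with hπdef
  have hHm : Measurable fun x : (ℝ × ℝ) × ChainConfig => K x.1.1 x.2 * K x.1.2 x.2 := by
    have h1 : Measurable fun x : (ℝ × ℝ) × ChainConfig => K x.1.1 x.2 :=
      hKjm.comp (measurable_fst.fst.prodMk measurable_snd)
    have h2 : Measurable fun x : (ℝ × ℝ) × ChainConfig => K x.1.2 x.2 :=
      hKjm.comp (measurable_fst.snd.prodMk measurable_snd)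
    exact h1.mul h2
  have hHint : Integrable (fun x : (ℝ × ℝ) × ChainConfig => K x.1.1 x.2 * K x.1.2 x.2)
      (π.prod μ) := by
    refine (integrable_prod_iff hHm.aestronglyMeasurable).2 ⟨Eventually.of_forall fun p => ?_, ?_⟩
    · exact (hK2 p.1).integrable_mul (hK2 p.2)
    · refine Integrable.mono' (integrable_const A) hHm.aestronglyMeasurable.norm.integral_prod_right'
        (Eventually.of_forall fun p => ?_)
      show ‖∫ σ, ‖K p.1 σ * K p.2 σ‖ ∂μ‖ ≤ A
      rw [Real.norm_eq_abs, abs_of_nonneg (integral_nonneg fun σ => norm_nonneg _)]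
      simp only [Real.norm_eq_abs]
      exact hKKabs p.1 p.2
  have hFint : Integrable (fun p : ℝ × ℝ => F (p.2 - p.1)) π := by
    refine Integrable.mono' (integrable_const A)
      (hF.comp (continuous_snd.sub continuous_fst)).aestronglyMeasurable
      (Eventually.of_forall fun p => ?_)
    rw [Real.norm_eq_abs]
    exact hFabs _
  -- the computation
  have hsq : ∀ σ, (∫ u, K u σ ∂ρ) ^ 2 = ∫ p, K p.1 σ * K p.2 σ ∂π := fun σ => by
    rw [sq, hπdef, ← integral_prod_mul (μ := ρ) (ν := ρ) (fun u => K u σ) (fun u => K u σ)]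
  have hHint' : Integrable (Function.uncurry fun (σ : ChainConfig) (p : ℝ × ℝ) => K p.1 σ * K p.2 σ)
      (μ.prod π) := hHint.swap
  have hswap : ∫ σ, ∫ p, K p.1 σ * K p.2 σ ∂π ∂μ = ∫ p, ∫ σ, K p.1 σ * K p.2 σ ∂μ ∂π :=
    integral_integral_swap hHint'
  have hmain : ∫ σ, (∫ u, K u σ ∂ρ) ^ 2 ∂μ = 2 * ∫ u in Ioc 0 t, (t - u) * F u := by
    calc ∫ σ, (∫ u, K u σ ∂ρ) ^ 2 ∂μ = ∫ σ, ∫ p, K p.1 σ * K p.2 σ ∂π ∂μ := by simp only [hsq]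
      _ = ∫ p, ∫ σ, K p.1 σ * K p.2 σ ∂μ ∂π := hswap
      _ = ∫ p, F (p.2 - p.1) ∂π := by simp only [hKK]
      _ = ∫ s, ∫ u, F (u - s) ∂ρ ∂ρ := integral_prod (fun p : ℝ × ℝ => F (p.2 - p.1)) hFint
      _ = 2 * ∫ u in Ioc 0 t, (t - u) * F u :=
          integral_Ioc_integral_Ioc_sub_eq hF (D.integral_mul_comp_flow_neg hD hg) ht
  -- the un-modified inner integral agrees with the `K`-version on `S`
  have hLHS : ∫ σ, (∫ u, g (D.flow u σ) ∂ρ) ^ 2 ∂μ = ∫ σ, (∫ u, K u σ ∂ρ) ^ 2 ∂μ := by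
    refine integral_congr_ae ?_
    filter_upwards [hSae] with σ hσ
    simp only [hKdef, indicator_of_mem hσ]
  rw [hLHS, hmain]

/-- **S1 `stub_blockVariance`** (infrastructure). The Einstein–Helfand / Følner representation of the heat
variance: in the arena of the crux, for every `τ ≥ 0`,
`n⁻¹ ∫ (∫_{(0,τ]} J_n∘φ_s)² dμ → 2∫_{(0,τ]}(τ−s)C(s)ds`, `J_n = Σ_{i<n} j_i`, `C = D.currentCorrelation μ`.
Proof: `∫ (∫_{(0,τ]} J_n∘φ_s)² dμ = 2∫_{(0,τ]}(τ−u)Φ_n(u)du` with `Φ_n(u) = ∫ J_n (J_n∘φ_u) dμ`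
(`bv_integral_sq_integral_Ioc_comp_flow`), then `n⁻¹Φ_n(u) → C(u)` pointwise
(`tendsto_inv_mul_integral_block_mul_block_flow`; a.e. commutation with the translations by rigidity
`flow_ae_eq_canonical` onto the canonical Buttà–Marchioro dynamics) under the domination
`|n⁻¹Φ_n(u)| ≤ n⁻¹Φ_n(0) ≤ B` (`abs_integral_block_mul_block_flow_le`); square-integrability of `j_x` and
continuity of `Φ_n` from the superstability estimate of the shift-invariant DLR state
(`hasSuperstabilityEstimate_of_isShiftInvariant_pinnedChain`, `continuous_integral_block_mul_block_flow`).
[cite: Helfand1960] [cite: Doyon2022, Lemma 4.5] -/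
theorem stub_blockVariance :
    ∀ ω₂ lam β γ : ℝ, 0 < ω₂ → 0 < lam → 0 < β → ∀ T : ℝ, 0 < T → ∀ μ : MeasureTheory.Measure Literature.MathematicalPhysics.KineticTheory.HeatConduction.ChainConfig, (Literature.MathematicalPhysics.KineticTheory.HeatConduction.pinnedChain ω₂ lam β γ).IsChainGibbsMeasure T μ → Literature.MathematicalPhysics.KineticTheory.HeatConduction.IsShiftInvariant μ → μ.map (fun σ : Literature.MathematicalPhysics.KineticTheory.HeatConduction.ChainConfig => fun x : ℤ => ((σ x).1, -(σ x).2)) = μ → ∀ D : Literature.MathematicalPhysics.KineticTheory.HeatConduction.InfiniteChainDynamics (Literature.MathematicalPhysics.KineticTheory.HeatConduction.pinnedChain ω₂ lam β γ), D.PreservesMeasure μ → (∀ t : ℝ, ∀ᵐ σ ∂μ, D.flow t (Literature.MathematicalPhysics.KineticTheory.HeatConduction.shift σ) = Literature.MathematicalPhysics.KineticTheory.HeatConduction.shift (D.flow t σ)) → (∀ t : ℝ, D.HasAbsConvergentCorrelation μ t) → Continuous (fun t : ℝ => D.currentCorrelation μ t) →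
      ∀ τ : ℝ, 0 ≤ τ →
        Filter.Tendsto
          (fun n : ℕ => (n : ℝ)⁻¹ *
            ∫ σ, (∫ s in Set.Ioc (0:ℝ) τ,
              ∑ i ∈ Finset.range n, (Literature.MathematicalPhysics.KineticTheory.HeatConduction.pinnedChain ω₂ lam β γ).bondCurrentZ (D.flow s σ) (i : ℤ)) ^ 2 ∂μ)
          Filter.atTop
          (nhds (2 * ∫ s in Set.Ioc (0:ℝ) τ, (τ - s) * D.currentCorrelation μ s)) := by
  intro ω₂ lam β γ hω hl hβ T hT μ hG hSI _ D hP _ hAC _ τ hτ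
  -- superstability of the shift-invariant Gibbs state and the polynomial data of the chain (in tree)
  have hss : (pinnedChain ω₂ lam β γ).HasSuperstabilityEstimate μ :=
    OscillatorChain.hasSuperstabilityEstimate_of_isShiftInvariant_pinnedChain γ hω hl.le hβ.le hT hG hSI
  haveI : IsProbabilityMeasure μ := hss.1
  have hU0 : ∀ q : ℝ, 0 ≤ (pinnedChain ω₂ lam β γ).U q :=
    OscillatorChain.pinnedChain_U_nonneg β γ hω.le hl.le
  have hUm : Measurable (pinnedChain ω₂ lam β γ).U := OscillatorChain.measurable_pinnedChain_U ω₂ lam β γ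
  have hU2 : OscillatorChain.IsEvenPolyOfDegree (pinnedChain ω₂ lam β γ).U 2 :=
    OscillatorChain.pinnedChain_isEvenPolyOfDegree_U β γ hω.le hl
  have hV2 : OscillatorChain.IsEvenPolyOfDegree (pinnedChain ω₂ lam β γ).V 2 :=
    OscillatorChain.pinnedChain_isEvenPolyOfDegree_V ω₂ lam γ hβ
  have hV0 : ∀ r : ℝ, 0 ≤ (pinnedChain ω₂ lam β γ).V r := hV2.choose_spec.2.2
  have hVc : Continuous (deriv (pinnedChain ω₂ lam β γ).V) :=
    hV2.contDiff_two.continuous_deriv (by norm_num)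
  have hj2 : ∀ x : ℤ, MemLp (fun σ => (pinnedChain ω₂ lam β γ).bondCurrentZ σ x) 2 μ := fun x =>
    hss.memLp_bondCurrentZ one_le_two hU0 hUm hV2 x ENNReal.ofNat_ne_top
  -- the canonical Buttà–Marchioro dynamics and RIGIDITY: `D` is `D♭` a.e. at all times, whence the
  -- a.e. commutation of `D.flow t` with every lattice translation
  obtain ⟨D', hcar, -, hid, -, -, -, hpresAll⟩ :=
    OscillatorChain.exists_bmDynamics (P := pinnedChain ω₂ lam β γ) one_le_two one_le_two hU2 hV2
  have hP' : D'.PreservesMeasure μ := hpresAll T μ hG hss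
  have hrig :=
    Summit.AtomisticToContinuum.FouriersLaw.Theorems.HeatVarianceCalculus.CanonicalRigidity.flow_ae_eq_canonical
      γ hω hl hβ hT hG hSI D D' hP hcar
  have hcomm : ∀ (t : ℝ) (x : ℤ), D.flow t ∘ chainShift x =ᵐ[μ] chainShift x ∘ D.flow t := by
    intro t x
    have h2 : ∀ᵐ σ ∂μ, ∀ u : ℝ, D.flow u (chainShift x σ) = D'.flow u (chainShift x σ) :=
      (hSI.measurePreserving_chainShift x).quasiMeasurePreserving.ae hrig
    filter_upwards [hrig, h2] with σ h1 h2
    rw [comp_apply, comp_apply, h2 t, h1 t]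
    exact D'.flow_chainShift_of_eq_id hcar hid hU0 hV0 t x σ
  -- the block correlations `Φ n t = ∫ J_n (J_n ∘ φ_t) dμ`
  set Φ : ℕ → ℝ → ℝ := fun n t => ∫ σ, (∑ i ∈ Finset.range n, (pinnedChain ω₂ lam β γ).bondCurrentZ σ i) *
      (∑ k ∈ Finset.range n, (pinnedChain ω₂ lam β γ).bondCurrentZ (D.flow t σ) k) ∂μ with hΦdef
  have hlim : ∀ t : ℝ, Tendsto (fun n : ℕ => (n : ℝ)⁻¹ * Φ n t) atTop
      (𝓝 (D.currentCorrelation μ t)) := fun t =>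
    D.tendsto_inv_mul_integral_block_mul_block_flow hP hSI hcomm hj2 (hAC t)
  have hΦc : ∀ n : ℕ, Continuous (Φ n) := fun n =>
    D.continuous_integral_block_mul_block_flow hss one_le_two hU0 hUm hV2 hP n
  have hJm : ∀ n : ℕ, Measurable fun σ : ChainConfig =>
      ∑ i ∈ Finset.range n, (pinnedChain ω₂ lam β γ).bondCurrentZ σ i := fun n =>
    Finset.measurable_sum _ fun i _ => measurable_bondCurrentZ _ i
  have hJ2 : ∀ n : ℕ, MemLp (fun σ : ChainConfig =>
      ∑ i ∈ Finset.range n, (pinnedChain ω₂ lam β γ).bondCurrentZ σ i) 2 μ :=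
    fun n => memLp_finsetSum _ fun i _ => hj2 i
  have hbound : ∀ (n : ℕ) (t : ℝ), |Φ n t| ≤ Φ n 0 := fun n t =>
    D.abs_integral_block_mul_block_flow_le hP hj2 n t
  -- (i) the Fubini identity for `g = J_n`
  have hfub : ∀ n : ℕ, ∫ σ, (∫ s in Ioc (0:ℝ) τ,
      ∑ i ∈ Finset.range n, (pinnedChain ω₂ lam β γ).bondCurrentZ (D.flow s σ) i) ^ 2 ∂μ =
        2 * ∫ u in Ioc (0:ℝ) τ, (τ - u) * Φ n u := fun n =>
    bv_integral_sq_integral_Ioc_comp_flow D hP (hJm n) (hJ2 n)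
      (fun σ hσ => continuous_finsetSum _ fun i _ => D.continuous_bondCurrentZ_flow hVc hσ i)
      (hΦc n) hτ
  have he : ∀ n : ℕ, (n : ℝ)⁻¹ * ∫ σ, (∫ s in Ioc (0:ℝ) τ,
      ∑ i ∈ Finset.range n, (pinnedChain ω₂ lam β γ).bondCurrentZ (D.flow s σ) i) ^ 2 ∂μ =
        2 * ∫ u in Ioc (0:ℝ) τ, (τ - u) * ((n : ℝ)⁻¹ * Φ n u) := fun n => by
    rw [hfub n]
    have h : ∫ u in Ioc (0:ℝ) τ, (τ - u) * ((n : ℝ)⁻¹ * Φ n u) =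
        (n : ℝ)⁻¹ * ∫ u in Ioc (0:ℝ) τ, (τ - u) * Φ n u := by
      rw [← integral_const_mul]
      refine integral_congr_ae (Eventually.of_forall fun u => ?_)
      ring
    rw [h]
    ring
  have hfun : (fun n : ℕ => (n : ℝ)⁻¹ * ∫ σ, (∫ s in Ioc (0:ℝ) τ,
      ∑ i ∈ Finset.range n, (pinnedChain ω₂ lam β γ).bondCurrentZ (D.flow s σ) i) ^ 2 ∂μ) =
        fun n : ℕ => 2 * ∫ u in Ioc (0:ℝ) τ, (τ - u) * ((n : ℝ)⁻¹ * Φ n u) := funext he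
  rw [hfun]
  -- (ii)-(iii) pointwise convergence `n⁻¹Φ_n → C` and dominated convergence on `(0, τ]`
  obtain ⟨B, hB⟩ := (hlim 0).bddAbove_range
  have hdom : Tendsto (fun n : ℕ => ∫ u in Ioc (0:ℝ) τ, (τ - u) * ((n : ℝ)⁻¹ * Φ n u)) atTop
      (𝓝 (∫ u in Ioc (0:ℝ) τ, (τ - u) * D.currentCorrelation μ u)) := by
    refine tendsto_integral_of_dominated_convergence (fun _ => τ * B)
      (fun n => ((continuous_const.sub continuous_id).mul
        (continuous_const.mul (hΦc n))).aestronglyMeasurable)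
      (integrable_const _) (fun n => ?_) (Eventually.of_forall fun u => (hlim u).const_mul (τ - u))
    filter_upwards [ae_restrict_mem measurableSet_Ioc] with u hu
    rw [Real.norm_eq_abs, abs_mul]
    refine mul_le_mul ?_ ?_ (abs_nonneg _) hτ
    · rw [abs_of_nonneg (by linarith [hu.2])]
      linarith [hu.1]
    · rw [abs_mul, abs_of_nonneg (inv_nonneg.2 (Nat.cast_nonneg n))]
      exact (mul_le_mul_of_nonneg_left (hbound n u) (inv_nonneg.2 (Nat.cast_nonneg n))).trans
        (hB ⟨n, rfl⟩)
  exact hdom.const_mul 2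

end Summit.AtomisticToContinuum.FouriersLaw.Theorems.HeatVarianceCeiling.DualCertificate

end
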